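import Mathlib
import Summits.Ventures.PercRepro2.Defs
import Summits.Ventures.PercRepro2.Independence
import Summits.Ventures.PercRepro2.Harris
import Summits.Ventures.PercRepro2.RedFavour

/-!
# RED-FAVOUR for a monotone weight
(blind cell PercRepro2, p2 g12; paper proofs/P2-G12-NONFULL.md §1, the «more generally» clause)

`RedFavour.lean` compares the probabilities of `A ∩ I` and `flip⁻¹ A ∩ I` for a decreasing event
`A` and an increasing event `I`.  Here the increasing event is replaced by a nonnegative
observable `g` increasing in the red set:

  `E[g · 1_A] ≤ E[g · 1_{flip⁻¹ A}]`  whenever `1 - wt e ≤ wt e` on every edge.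

Proof: `E[g 1_A] = E[g] - E[g 1_{Aᶜ}] ≤ E[g] - E[g] P(Aᶜ) = E[g] P(A)` (Harris for the monotone
pair `g`, `1_{Aᶜ}`), then `P_wt(A) ≤ P_{1-wt}(A) = P_wt(flip⁻¹ A)` (monotone coupling and the
reflection), then `E[g] P(flip⁻¹ A) ≤ E[g 1_{flip⁻¹ A}]` (Harris for the monotone pair `g`,
`1_{flip⁻¹ A}`).
-/

namespace Summit.Ventures.PercRepro2

namespace RedFavour

section Function

variable {E : Type*} [Fintype E] [DecidableEq E] {R : Type*} [CommRing R] [PartialOrder R]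
  [IsStrictOrderedRing R]

omit [Fintype E] [DecidableEq E] [PartialOrder R] [IsStrictOrderedRing R] in
/-- `g = g · 1_A + g · 1_{Aᶜ}` pointwise. -/
lemma mul_indicator_add_mul_indicator_compl (g : Config E → R) (A : Set (Config E))
    (ω : Config E) : g ω * A.indicator 1 ω + g ω * Aᶜ.indicator 1 ω = g ω := by
  by_cases h : ω ∈ A
  · simp [h]
  · simp [h]

omit [PartialOrder R] [IsStrictOrderedRing R] in
/-- Splitting an expectation along an event. -/
lemma expect_mul_indicator_add_expect_mul_indicator_compl (wt : E → R) (g : Config E → R)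
    (A : Set (Config E)) :
    expect wt (g * A.indicator 1) + expect wt (g * Aᶜ.indicator 1) = expect wt g := by
  rw [← expect_add]
  congr 1
  funext ω
  exact mul_indicator_add_mul_indicator_compl g A ω

/-- Harris, mixed form for a monotone weight and a decreasing event:
`E[g · 1_A] ≤ E[g] · P(A)`. -/
lemma expect_mul_indicator_le_expect_mul_prob {wt : E → R} (hwt : IsProbVec wt)
    {A : Set (Config E)} (hA : IsLowerSet A) {g : Config E → R} (hg : Monotone g) :
    expect wt (g * A.indicator 1) ≤ expect wt g * prob wt A := by
  have h := expect_mul_expect_le_expect_mul hwt hg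
    (monotone_indicator_of_isUpperSet (R := R) hA.compl)
  have hsplit := expect_mul_indicator_add_expect_mul_indicator_compl wt g A
  rw [← prob_eq_expect_indicator] at h
  rw [prob_compl] at h
  -- h : E[g] * (1 - P(A)) ≤ E[g · 1_{Aᶜ}];  hsplit : E[g 1_A] + E[g 1_{Aᶜ}] = E[g]
  have key : expect wt (g * A.indicator 1) = expect wt g - expect wt (g * Aᶜ.indicator 1) := by
    rw [← hsplit]; ring
  rw [key]
  calc expect wt g - expect wt (g * Aᶜ.indicator 1)
      ≤ expect wt g - expect wt g * (1 - prob wt A) := sub_le_sub_left h _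
    _ = expect wt g * prob wt A := by ring

/-- **RED-FAVOUR, function form.** For a nonnegative observable `g` increasing in the red set
and a decreasing event `A`, under weights with `1 - wt e ≤ wt e`:
`E[g · 1_A] ≤ E[g · 1_{flip⁻¹ A}]`. -/
theorem expect_mul_indicator_le_expect_mul_indicator_preimage_flip {wt : E → R}
    (hwt : IsProbVec wt) (hhalf : ∀ e, 1 - wt e ≤ wt e) {A : Set (Config E)} (hA : IsLowerSet A)
    {g : Config E → R} (hg : Monotone g) (hg0 : ∀ ω, 0 ≤ g ω) :
    expect wt (g * A.indicator 1) ≤ expect wt (g * (flip ⁻¹' A).indicator 1) := by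
  have hbar : IsProbVec (pbar wt) := isProbVec_pbar hwt
  have hle : pbar wt ≤ wt := fun e => hhalf e
  have hg0' : 0 ≤ expect wt g := expect_nonneg hwt hg0
  have h1 : expect wt (g * A.indicator 1) ≤ expect wt g * prob wt A :=
    expect_mul_indicator_le_expect_mul_prob hwt hA hg
  have h2 : prob wt A ≤ prob (pbar wt) A := prob_le_prob_of_le_of_isLowerSet hbar hwt hle hA
  have h3 : prob (pbar wt) A = prob wt (flip ⁻¹' A) := (prob_preimage_flip wt A).symm
  have h4 : expect wt g * prob wt (flip ⁻¹' A) ≤ expect wt (g * (flip ⁻¹' A).indicator 1) := by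
    rw [prob_eq_expect_indicator]
    exact expect_mul_expect_le_expect_mul hwt hg
      (monotone_indicator_of_isUpperSet (R := R) (isUpperSet_preimage_flip hA))
  calc expect wt (g * A.indicator 1) ≤ expect wt g * prob wt A := h1
    _ ≤ expect wt g * prob (pbar wt) A := mul_le_mul_of_nonneg_left h2 hg0'
    _ = expect wt g * prob wt (flip ⁻¹' A) := by rw [h3]
    _ ≤ expect wt (g * (flip ⁻¹' A).indicator 1) := h4

end Function

end RedFavour

end Summit.Ventures.PercRepro2
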